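import Mathlib
import Summits.Ventures.PercRepro2.Defs
import Summits.Ventures.PercRepro2.Independence
import Summits.Ventures.PercRepro2.Harris
import Summits.Ventures.PercRepro2.Graph
import Summits.Ventures.PercRepro2.Exploration
import Summits.Ventures.PercRepro2.Events
import Summits.Ventures.PercRepro2.Induced
import Summits.Ventures.PercRepro2.GateCylinder
import Summits.Ventures.PercRepro2.CCTRootEdge
import Summits.Ventures.PercRepro2.CDNestedStep


/-!
# Pinning a whole route: the chain lemmas (blind cell PercRepro2, mine-a g34; MINE-A.md §89.7,
proofs/MINEA-CD-NESTED.md §2 (B))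

A ROUTE is a list `L` of triples `(e, v, y)` with `ends e = s(v, y)` whose `v`'s are WALK-ORDERED from
a vertex set `S`: the `v` of the `i`-th triple lies in `S` or is the `y` of an earlier triple.  Pinning
the edges of `L` open one by one from the forced vector `p[B ↦ 1]` (with `S` joined by `B`) and
iterating `CDNestedStep.step_beta` / `step_gamma`: `chain_beta` (`P_B(Q U) · P_{B ∪ L}(Q) ≤
P_{B ∪ L}(Q U) · P_B(Q)` for every up-set `U`), `chain_gamma` (`P_{B ∪ L}(Q f) · P_B(Q) ≤ P_B(Q f) ·
P_{B ∪ L}(Q)`), `chain_joined` (`S ∪ {the y's of L}` is joined by `B ∪ L`), where `B ∪ L` is the forced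
set `L.foldl (fun acc t => insert t.1 acc) B`.  Cleared forms compose through the monotonicity of
`P(Q)` under pinning (`prob_Q_forceOpen_insert_le`).  No definition; one seat.
-/

namespace Summit.Ventures.PercRepro2

namespace CDNestedRoute

section Chain

variable {V : Type*} {E : Type*} [Fintype E] [DecidableEq E] [Fintype V] [DecidableEq V]
  {R : Type*} [Field R] [LinearOrder R] [IsStrictOrderedRing R]

omit [Fintype V] [DecidableEq V] in
/-- Pinning an edge open shrinks `Q` under forced vectors. -/
lemma prob_Q_forceOpen_insert_le (p : E → R) (hp : IsProbVec p) {ends : E → Sym2 V} (e : E)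
    (B : Finset E) (a₁ a₂ : V) :
    prob (GateCylinder.forceOpen p (insert e B)) (connEvent ends a₁ a₂)ᶜ ≤
      prob (GateCylinder.forceOpen p B) (connEvent ends a₁ a₂)ᶜ := by
  rw [CDNestedStep.forceOpen_insert, CCT.prob_update_one_eq]
  refine prob_mono (GateCylinder.isProbVec_forceOpen hp B) fun ω hω => ?_
  simp only [Set.mem_setOf_eq, Set.mem_compl_iff, mem_connEvent] at hω ⊢
  exact fun hc => hω (conn_mono (CDNestedStep.le_update_true' ω e) hc)

omit [Fintype E] [DecidableEq E] [Fintype V] [DecidableEq V] in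
/-- Composition of two cleared `β`-inequalities along a chain where `P(Q)` does not increase. -/
lemma cleared_trans {N₀ D₀ N₁ D₁ N₂ D₂ : R} (h01 : N₀ * D₁ ≤ N₁ * D₀) (h12 : N₁ * D₂ ≤ N₂ * D₁)
    (hD₀ : 0 ≤ D₀) (hD₁ : 0 ≤ D₁) (hD₂ : 0 ≤ D₂) (hN₂ : 0 ≤ N₂) (hN₂D : N₂ ≤ D₂)
    (hD₂₁ : D₂ ≤ D₁) : N₀ * D₂ ≤ N₂ * D₀ := by
  rcases hD₁.lt_or_eq with hpos | hzero
  · refine le_of_mul_le_mul_left ?_ hpos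
    calc D₁ * (N₀ * D₂) = (N₀ * D₁) * D₂ := by ring
      _ ≤ (N₁ * D₀) * D₂ := mul_le_mul_of_nonneg_right h01 hD₂
      _ = (N₁ * D₂) * D₀ := by ring
      _ ≤ (N₂ * D₁) * D₀ := mul_le_mul_of_nonneg_right h12 hD₀
      _ = D₁ * (N₂ * D₀) := by ring
  · have h2 : D₂ = 0 := le_antisymm (hzero ▸ hD₂₁) hD₂
    have h3 : N₂ = 0 := le_antisymm (h2 ▸ hN₂D) hN₂
    rw [h2, h3]
    simp

omit [Fintype E] [DecidableEq E] [Fintype V] [DecidableEq V] in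
/-- Composition of two cleared `γ`-inequalities along a chain where `P(Q)` does not increase. -/
lemma cleared_trans' {N₀ D₀ N₁ D₁ N₂ D₂ : R} (h01 : N₁ * D₀ ≤ N₀ * D₁) (h12 : N₂ * D₁ ≤ N₁ * D₂)
    (hD₀ : 0 ≤ D₀) (hD₁ : 0 ≤ D₁) (hD₂ : 0 ≤ D₂) (hN₂ : 0 ≤ N₂) (hN₂D : N₂ ≤ D₂)
    (hD₂₁ : D₂ ≤ D₁) : N₂ * D₀ ≤ N₀ * D₂ := by
  rcases hD₁.lt_or_eq with hpos | hzero
  · refine le_of_mul_le_mul_left ?_ hpos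
    calc D₁ * (N₂ * D₀) = (N₂ * D₁) * D₀ := by ring
      _ ≤ (N₁ * D₂) * D₀ := mul_le_mul_of_nonneg_right h12 hD₀
      _ = (N₁ * D₀) * D₂ := by ring
      _ ≤ (N₀ * D₁) * D₂ := mul_le_mul_of_nonneg_right h01 hD₂
      _ = D₁ * (N₀ * D₂) := by ring
  · have h2 : D₂ = 0 := le_antisymm (hzero ▸ hD₂₁) hD₂
    have h3 : N₂ = 0 := le_antisymm (h2 ▸ hN₂D) hN₂
    rw [h2, h3]
    simp

omit [Fintype E] [DecidableEq E] [Fintype V] in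
/-- A route is WALK-ORDERED from `S` if each `v` lies in `S` or is the `y` of an earlier triple. -/
theorem walk_tail {S : Finset V} {t : E × V × V} {L : List (E × V × V)}
    (h : ∀ i (hi : i < (t :: L).length), ((t :: L).get ⟨i, hi⟩).2.1 ∈
      S ∪ (((t :: L).take i).map (fun u => u.2.2)).toFinset) :
    ∀ i (hi : i < L.length), (L.get ⟨i, hi⟩).2.1 ∈
      insert t.2.2 S ∪ ((L.take i).map (fun u => u.2.2)).toFinset := by
  intro i hi
  have := h (i + 1) (by simp [hi])
  simp only [List.get_eq_getElem, List.getElem_cons_succ, List.take_succ_cons, List.map_cons,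
    List.toFinset_cons, Finset.mem_union, Finset.mem_insert] at this ⊢
  tauto

omit [Fintype E] [Fintype V] in
/-- **Pinning a route keeps the joined set joined**: if `S` is joined by `B` and the route `L` is
walk-ordered from `S`, then `S ∪ {y's of L}` is joined by `B ∪ {edges of L}`. -/
theorem chain_joined {ends : E → Sym2 V} {a₁ : V} :
    ∀ (L : List (E × V × V)) (B : Finset E) (S : Finset V),
      (∀ ω : Config E, ω ∈ GateCylinder.cylinder B → ∀ v ∈ S, Conn ends ω a₁ v) →
      (∀ t ∈ L, ends t.1 = s(t.2.1, t.2.2)) →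
      (∀ i (hi : i < L.length), (L.get ⟨i, hi⟩).2.1 ∈
        S ∪ ((L.take i).map (fun u => u.2.2)).toFinset) →
      ∀ ω : Config E, ω ∈ GateCylinder.cylinder (L.foldl (fun acc t => insert t.1 acc) B) →
        ∀ v ∈ L.foldl (fun acc t => insert t.2.2 acc) S, Conn ends ω a₁ v := by
  intro L
  induction L with
  | nil => intro B S hJ _ _; simpa using hJ
  | cons t L ih =>
    intro B S hJ hends hwalk
    have ht : t.2.1 ∈ S := by
      have := hwalk 0 (by simp)
      simpa using this
    have hJ' := CDNestedStep.joined_insert hJ (hends t (List.mem_cons_self ..)) ht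
    have hends' : ∀ u ∈ L, ends u.1 = s(u.2.1, u.2.2) := fun u hu => hends u (List.mem_cons_of_mem t hu)
    have hwalk' := walk_tail hwalk
    have := ih (insert t.1 B) (insert t.2.2 S) hJ' hends' hwalk'
    simpa using this

/-- **The `β`-chain**: pinning a walk-ordered route raises `P(U ∣ Q)` (cleared form). -/
theorem chain_beta (p : E → R) (hp : IsProbVec p) {ends : E → Sym2 V} {a₁ a₂ : V}
    {𝓔 : Set (Set V)} (h𝓔 : IsUpperSet 𝓔) :
    ∀ (L : List (E × V × V)) (B : Finset E) (S : Finset V),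
      (∀ ω : Config E, ω ∈ GateCylinder.cylinder B → ∀ v ∈ S, Conn ends ω a₁ v) → a₁ ∈ S →
      (∀ t ∈ L, ends t.1 = s(t.2.1, t.2.2)) →
      (∀ i (hi : i < L.length), (L.get ⟨i, hi⟩).2.1 ∈
        S ∪ ((L.take i).map (fun u => u.2.2)).toFinset) →
      prob (GateCylinder.forceOpen p B) ((connEvent ends a₁ a₂)ᶜ ∩ clusterInEvent ends a₁ 𝓔) *
          prob (GateCylinder.forceOpen p (L.foldl (fun acc t => insert t.1 acc) B))
            (connEvent ends a₁ a₂)ᶜ ≤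
        prob (GateCylinder.forceOpen p (L.foldl (fun acc t => insert t.1 acc) B))
            ((connEvent ends a₁ a₂)ᶜ ∩ clusterInEvent ends a₁ 𝓔) *
          prob (GateCylinder.forceOpen p B) (connEvent ends a₁ a₂)ᶜ := by
  intro L
  induction L with
  | nil =>
    intro B S _ _ _ _
    simp only [List.foldl_nil]
    exact le_rfl
  | cons t L ih =>
    intro B S hJ ha₁ hends hwalk
    have ht : t.2.1 ∈ S := by
      have := hwalk 0 (by simp)
      simpa using this
    have hJ' := CDNestedStep.joined_insert hJ (hends t (List.mem_cons_self ..)) ht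
    have hends' : ∀ u ∈ L, ends u.1 = s(u.2.1, u.2.2) := fun u hu => hends u (List.mem_cons_of_mem t hu)
    have hwalk' := walk_tail hwalk
    have ha₁' : a₁ ∈ insert t.2.2 S := Finset.mem_insert_of_mem ha₁
    -- one step, then the rest of the route
    have h1 := CDNestedStep.step_beta p hp hJ ha₁ (hends t (List.mem_cons_self ..)) ht h𝓔 (a₂ := a₂)
    have h2 := ih (insert t.1 B) (insert t.2.2 S) hJ' ha₁' hends' hwalk'
    simp only [List.foldl_cons] at h2 ⊢
    -- `P(Q)` does not increase along the chain
    have hmono : ∀ (L' : List (E × V × V)) (B' : Finset E),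
        prob (GateCylinder.forceOpen p (L'.foldl (fun acc t => insert t.1 acc) B'))
          (connEvent ends a₁ a₂)ᶜ ≤ prob (GateCylinder.forceOpen p B') (connEvent ends a₁ a₂)ᶜ := by
      intro L'
      induction L' with
      | nil => intro B'; simp
      | cons u L' ih' =>
        intro B'
        simp only [List.foldl_cons]
        exact le_trans (ih' (insert u.1 B')) (prob_Q_forceOpen_insert_le p hp u.1 B' a₁ a₂)
    have hpB : IsProbVec (GateCylinder.forceOpen p (L.foldl (fun acc t => insert t.1 acc) (insert t.1 B))) :=
      GateCylinder.isProbVec_forceOpen hp _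
    exact cleared_trans h1 h2 (prob_nonneg (GateCylinder.isProbVec_forceOpen hp B) _)
      (prob_nonneg (GateCylinder.isProbVec_forceOpen hp _) _) (prob_nonneg hpB _) (prob_nonneg hpB _)
      (prob_mono hpB Set.inter_subset_left) (hmono L (insert t.1 B))

/-- **The `γ`-chain**: pinning a walk-ordered route lowers `P(o ∈ C₂ ∣ Q)` (cleared form). -/
theorem chain_gamma (p : E → R) (hp : IsProbVec p) {ends : E → Sym2 V} {a₁ a₂ o : V} :
    ∀ (L : List (E × V × V)) (B : Finset E) (S : Finset V),
      (∀ ω : Config E, ω ∈ GateCylinder.cylinder B → ∀ v ∈ S, Conn ends ω a₁ v) → a₁ ∈ S →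
      (∀ t ∈ L, ends t.1 = s(t.2.1, t.2.2)) →
      (∀ i (hi : i < L.length), (L.get ⟨i, hi⟩).2.1 ∈
        S ∪ ((L.take i).map (fun u => u.2.2)).toFinset) →
      prob (GateCylinder.forceOpen p (L.foldl (fun acc t => insert t.1 acc) B))
          ((connEvent ends a₁ a₂)ᶜ ∩ connEvent ends a₂ o) *
          prob (GateCylinder.forceOpen p B) (connEvent ends a₁ a₂)ᶜ ≤
        prob (GateCylinder.forceOpen p B) ((connEvent ends a₁ a₂)ᶜ ∩ connEvent ends a₂ o) *
          prob (GateCylinder.forceOpen p (L.foldl (fun acc t => insert t.1 acc) B))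
            (connEvent ends a₁ a₂)ᶜ := by
  intro L
  induction L with
  | nil =>
    intro B S _ _ _ _
    simp only [List.foldl_nil]
    exact le_rfl
  | cons t L ih =>
    intro B S hJ ha₁ hends hwalk
    have ht : t.2.1 ∈ S := by
      have := hwalk 0 (by simp)
      simpa using this
    have hJ' := CDNestedStep.joined_insert hJ (hends t (List.mem_cons_self ..)) ht
    have hends' : ∀ u ∈ L, ends u.1 = s(u.2.1, u.2.2) := fun u hu => hends u (List.mem_cons_of_mem t hu)
    have hwalk' := walk_tail hwalk
    have ha₁' : a₁ ∈ insert t.2.2 S := Finset.mem_insert_of_mem ha₁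
    have h1 := CDNestedStep.step_gamma p hp hJ ha₁ (hends t (List.mem_cons_self ..)) ht (a₂ := a₂) (o := o)
    have h2 := ih (insert t.1 B) (insert t.2.2 S) hJ' ha₁' hends' hwalk'
    simp only [List.foldl_cons] at h2 ⊢
    have hmono : ∀ (L' : List (E × V × V)) (B' : Finset E),
        prob (GateCylinder.forceOpen p (L'.foldl (fun acc t => insert t.1 acc) B'))
          (connEvent ends a₁ a₂)ᶜ ≤ prob (GateCylinder.forceOpen p B') (connEvent ends a₁ a₂)ᶜ := by
      intro L'
      induction L' with
      | nil => intro B'; simp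
      | cons u L' ih' =>
        intro B'
        simp only [List.foldl_cons]
        exact le_trans (ih' (insert u.1 B')) (prob_Q_forceOpen_insert_le p hp u.1 B' a₁ a₂)
    have hpB : IsProbVec (GateCylinder.forceOpen p (L.foldl (fun acc t => insert t.1 acc) (insert t.1 B))) :=
      GateCylinder.isProbVec_forceOpen hp _
    exact cleared_trans' h1 h2 (prob_nonneg (GateCylinder.isProbVec_forceOpen hp B) _)
      (prob_nonneg (GateCylinder.isProbVec_forceOpen hp _) _) (prob_nonneg hpB _) (prob_nonneg hpB _)
      (prob_mono hpB Set.inter_subset_left) (hmono L (insert t.1 B))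

end Chain

end CDNestedRoute

end Summit.Ventures.PercRepro2
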